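import Mathlib
import HarnessLib
import Summits.CriticalPhenomena.PercolationContinuityZ3.Theses.PercLowPointHalfSpace
import Summits.CriticalPhenomena.PercolationContinuityZ3.Theorems.PercLowPointHalfSpaceLowPointBookkeepingGlue
import Summits.CriticalPhenomena.PercolationContinuityZ3.Theorems.PercLowPointHalfSpaceAssemblyColumnTelescoping
import Summits.CriticalPhenomena.PercolationContinuityZ3.Theorems.QuantitativeBGN.Negative.LoadBearing
import Literature.Probability.Percolation.HalfSpaceFloorDilution
import Literature.Probability.Percolation.SiteMonotonicity

/-!
# Glue of line SketchIdeator1 (floor-russo) for the crux `LowPointBookkeeping` — (2/2) conclusions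

Crux item `stmt-CriticalPhenomena-14713`,
`K := Summit.CriticalPhenomena.PercolationContinuityZ3.Theses.PercLowPointHalfSpace.LowPointBookkeeping`
(`BoundaryTwoArmDecay → TallClusterMassBound → QuantitativeBGN → [P_{p_c}(0 ↔ n e₀) → 0]`).
Sequel of `…LowPointBookkeepingGlue.lean` (window bound); hypotheses (A♯ₛ) = `stub_twoArmSharpFloor`
and (B♯) = `stub_noFatHalfBox` verbatim (the line's two OPEN registered stubs, new hypotheses).

Main results (all sorry-free):

* `percolationContinuityZ3_of_sharp : (A♯ₛ) → (B♯) → PercolationContinuityZ3` — `θ(p_c(ℤ³)) = 0`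
  from the two inputs ALONE: `θ² ≤ τ(0,w)` for every `w` (`Grimmett1999_theta_sq_le_openConn_holds`),
  so `θ(p_c)² ≤ (1/|W_L|) Σ_{w ∈ W_L} τ(0,w) ≤ π_s(L) + 4 C L^{-κ/2} → 0`; the floor term only needs
  the QUALITATIVE Barsky–Grimmett–Newman limit `π_s(L) = P_{p_c}(arm_ℍ(0,L)) → 0`
  (`QuantitativeBGN.Negative.tendsto_armH_criticalProb`, in tree) — crux C is not needed;
* `lowPointBookkeeping_of_sharp : (A♯ₛ) → (B♯) → LowPointBookkeeping` (the crux; its own hypotheses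
  A, B, C are idle) and `assembly_of_sharp : (A♯ₛ) → (B♯) → Assembly`;
* `boundaryTwoArmDecay_of_sharp : (A♯ₛ) → BoundaryTwoArmDecay` — (A♯ₛ) at `s = 1`, `e = (0,1,0)`
  implies the route's crux A (exponent `11/4 + κ ≥ 5/2 + κ`; at `s = 1` the floor-diluted measure
  agrees with `P_{p_c}` on events determined by the pairs of points of `ℍ`,
  `floorDilutedPercolation_one_apply_eq`).

So restating the route's A as (A♯ₛ) and B as (B♯) makes K (indeed the conjunct) a theorem of the
tree; conversely no derivation of K from A, B, C as typed is known (crux work files, `Disproof.lean`).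
-/

noncomputable section

open MeasureTheory Filter Topology
open Literature.Probability.Percolation Literature.Probability.LatticeModels
open scoped ENNReal

namespace Summit.CriticalPhenomena.PercolationContinuityZ3.Theorems.FloorRusso.Glue

open Summit.CriticalPhenomena.PercolationContinuityZ3.Theses.PercLowPointHalfSpace
open Summit.CriticalPhenomena.PercolationContinuityZ3.Theorems.FloorRusso.Coupling (HS μH)

/-- The critical bond percolation measure on `ℤ³` (local notation). -/
local notation3 (prettyPrint := false) "μc" =>
  (bondPercolation (zdGraph 3) (criticalProbI 3) : Measure (BondConfig (Site 3)))

/-- The window `W_L = B_L + 2L e₀` (local notation). -/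
local notation3 (prettyPrint := false) "𝑾⟦" L "⟧" =>
  ((box 3 L).image fun y : Site 3 => y + Pi.single 0 (((2 * L : ℕ)) : ℤ))

/-- The boundary one-arm event `arm_ℍ(0, r)` (verbatim the route's; local notation). -/
local notation3 (prettyPrint := false) "𝑻⟦" r "⟧" =>
  ({ω | ∃ y : Site 3, (∃ i : Fin 3, ((r : ℕ) : ℤ) ≤ |y i|) ∧ ω ∈ openConnIn HS 0 y} :
    Set (BondConfig (Site 3)))

/-- Hypothesis (A♯ₛ): the registered stub `stub_twoArmSharpFloor`, verbatim (local notation). -/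
local notation3 (prettyPrint := false) "SharpFloorTwoArm" =>
  (∃ κ C : ℝ, 0 < κ ∧ ∀ s : unitInterval, ∀ e ∈ ({Pi.single 1 1, Pi.single 1 (-1), Pi.single 2 1, Pi.single 2 (-1)} : Finset (Site 3)), ∀ r : ℕ, 1 ≤ r →
      (floorDilutedPercolation 3 (criticalProbI 3) s).real
        ({ω | ∃ y : Site 3, (∃ i : Fin 3, ((r : ℕ) : ℤ) ≤ |y i|) ∧ ω ∈ openConnIn {x : Site 3 | 0 ≤ x 0} 0 y} ∩ {ω | ∃ y : Site 3, (∃ i : Fin 3, ((r : ℕ) : ℤ) ≤ |y i - e i|) ∧ ω ∈ openConnIn {x : Site 3 | 0 ≤ x 0} e y} ∩ (openConnIn {x : Site 3 | 0 ≤ x 0} 0 e)ᶜ) ≤ C * (r : ℝ) ^ (-(11 / 4 + κ)) : Prop)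

/-- Hypothesis (B♯): the registered stub `stub_noFatHalfBox`, verbatim (local notation). -/
local notation3 (prettyPrint := false) "NoFatHalfBox" =>
  (∃ C : ℝ, 0 < C ∧ ∀ x ∈ insert (0 : Site 3) ({Pi.single 1 1, Pi.single 1 (-1), Pi.single 2 1, Pi.single 2 (-1)} : Finset (Site 3)), ∀ n : ℕ, 1 ≤ n →
      (floorDilutedPercolation 3 (criticalProbI 3) 1).real
        {ω | C * (n : ℝ) ^ ((11 : ℝ) / 4) ≤ (clusterMaxIn (((box 3 n).image fun y : Site 3 => x + y).filter fun z : Site 3 => 0 ≤ z 0) ω : ℝ)}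
          ≤ Real.exp (-1) : Prop)

/-! ### Step 6: window average → 0 and `θ(p_c) = 0` -/

/-- `π_s(L) = P_{p_c}(arm_ℍ(0,L)) → 0` — the QUALITATIVE Barsky–Grimmett–Newman limit, in tree
(`QuantitativeBGN.Negative.tendsto_armH_criticalProb`); no rate is needed for the floor term. -/
theorem tendsto_tall0 : Tendsto (fun L : ℕ => (μc).real (𝑻⟦L⟧)) atTop (𝓝 0) :=
  QuantitativeBGN.Negative.tendsto_armH_criticalProb

/-- **The window average of `τ_{p_c}(0, ·)` tends to `0`** (from (A♯ₛ) and (B♯)):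
`(1/|W_L|) Σ_{w ∈ W_L} τ(0,w) ≤ π_s(L) + 4 C L^{-κ/2}` for `L ≥ 1`, and both majorants tend to `0`. -/
theorem tendsto_windowAverage (hA : SharpFloorTwoArm) (hB : NoFatHalfBox) :
    Tendsto (fun L : ℕ => (∑ w ∈ 𝑾⟦L⟧, (μc).real (openConn (0 : Site 3) w)) / ((𝑾⟦L⟧).card : ℝ))
      atTop (𝓝 0) := by
  obtain ⟨κ, C, hκ, hC0, hbound⟩ := exists_windowSum_bound hA hB
  -- both majorants tend to 0
  have h1 := tendsto_tall0
  have h2 : Tendsto (fun L : ℕ => (Coupling.nbrs.card : ℝ) * C * (L : ℝ) ^ (-(κ / 2))) atTop (𝓝 0) := by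
    have h := (tendsto_rpow_neg_atTop (by linarith : 0 < κ / 2)).comp tendsto_natCast_atTop_atTop
    simpa using h.const_mul ((Coupling.nbrs.card : ℝ) * C)
  have h12 := h1.add h2
  rw [add_zero] at h12
  refine tendsto_of_tendsto_of_tendsto_of_le_of_le' tendsto_const_nhds h12
    (Eventually.of_forall fun L => div_nonneg (Finset.sum_nonneg fun _ _ => measureReal_nonneg)
      (Nat.cast_nonneg _)) ?_
  filter_upwards [eventually_ge_atTop 1] with L hL
  -- the real-valued bound at a fixed `L ≥ 1`
  have hb := hbound L hL
  have hcardW := card_window L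
  set W := 𝑾⟦L⟧ with hW
  set T := 𝑻⟦L⟧ with hT
  have hcard : (W.card : ℝ) = (2 * (L : ℝ) + 1) ^ 3 := by
    rw [hcardW]; push_cast; ring
  have hcard_pos : (0 : ℝ) < W.card := by rw [hcard]; positivity
  have hL3 : (L : ℝ) ^ (3 : ℝ) ≤ (W.card : ℝ) := by
    rw [hcard, show ((3 : ℝ)) = ((3 : ℕ) : ℝ) by norm_num, Real.rpow_natCast]
    have : (L : ℝ) ≤ 2 * (L : ℝ) + 1 := by linarith [(Nat.cast_nonneg L : (0 : ℝ) ≤ L)]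
    exact pow_le_pow_left₀ (Nat.cast_nonneg L) this 3
  have hsum : ∑ w ∈ W, (μc).real (openConn (0 : Site 3) w) =
      (∑ w ∈ W, μc (openConn (0 : Site 3) w)).toReal := by
    rw [ENNReal.toReal_sum fun _ _ => measure_ne_top _ _]; rfl
  have hfin : (W.card : ℝ≥0∞) * μc T +
      Coupling.nbrs.card * ENNReal.ofReal (C * (L : ℝ) ^ (3 - κ / 2)) ≠ ∞ := by
    refine ENNReal.add_ne_top.2 ⟨ENNReal.mul_ne_top (by simp) (measure_ne_top _ _), ?_⟩
    exact ENNReal.mul_ne_top (by simp) ENNReal.ofReal_ne_top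
  have hb' : ∑ w ∈ W, (μc).real (openConn (0 : Site 3) w) ≤
      (W.card : ℝ) * (μc).real T + (Coupling.nbrs.card : ℝ) * (C * (L : ℝ) ^ (3 - κ / 2)) := by
    rw [hsum]
    have := ENNReal.toReal_mono hfin hb
    rw [ENNReal.toReal_add (ENNReal.mul_ne_top (by simp) (measure_ne_top _ _))
      (ENNReal.mul_ne_top (by simp) ENNReal.ofReal_ne_top), ENNReal.toReal_mul,
      ENNReal.toReal_mul, ENNReal.toReal_ofReal (by positivity)] at this
    simpa [measureReal_def] using this
  rw [div_le_iff₀ hcard_pos]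
  have hLpos : (0 : ℝ) < L := by exact_mod_cast hL
  have hsplit : (L : ℝ) ^ (3 - κ / 2) = (L : ℝ) ^ (3 : ℝ) * (L : ℝ) ^ (-(κ / 2)) := by
    rw [← Real.rpow_add hLpos]; ring_nf
  calc ∑ w ∈ W, (μc).real (openConn (0 : Site 3) w)
      ≤ (W.card : ℝ) * (μc).real T + (Coupling.nbrs.card : ℝ) * (C * (L : ℝ) ^ (3 - κ / 2)) := hb'
    _ = (W.card : ℝ) * (μc).real T +
        (Coupling.nbrs.card : ℝ) * C * (L : ℝ) ^ (-(κ / 2)) * (L : ℝ) ^ (3 : ℝ) := by rw [hsplit]; ring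
    _ ≤ (W.card : ℝ) * (μc).real T +
        (Coupling.nbrs.card : ℝ) * C * (L : ℝ) ^ (-(κ / 2)) * (W.card : ℝ) := by gcongr
    _ = ((μc).real T + (Coupling.nbrs.card : ℝ) * C * (L : ℝ) ^ (-(κ / 2))) * (W.card : ℝ) := by
        ring

/-- **`θ(p_c(ℤ³)) = 0` from (A♯ₛ) and (B♯)** (window average and `θ² ≤ τ(0,w)` for every `w`). -/
theorem percolationContinuityZ3_of_sharp (hA : SharpFloorTwoArm) (hB : NoFatHalfBox) :
    _root_.PercolationContinuityZ3 := by
  show theta (zdGraph 3) (0 : Site 3) (criticalProbI 3) = 0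
  set θ := theta (zdGraph 3) (0 : Site 3) (criticalProbI 3) with hθ
  have hsq : θ ^ 2 ≤ 0 := by
    refine ge_of_tendsto' (tendsto_windowAverage hA hB) fun L => ?_
    have hne : (𝑾⟦L⟧).Nonempty :=
      ⟨(0 : Site 3) + Pi.single 0 (((2 * L : ℕ)) : ℤ), Finset.mem_image_of_mem _ (zero_mem_box 3 L)⟩
    set W := 𝑾⟦L⟧ with hW
    have hc : (0 : ℝ) < (W.card : ℝ) := by exact_mod_cast Finset.card_pos.mpr hne
    show θ ^ 2 ≤ (∑ w ∈ W, (μc).real (openConn (0 : Site 3) w)) / (W.card : ℝ)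
    rw [le_div_iff₀ hc, mul_comm, ← nsmul_eq_mul, ← Finset.sum_const]
    exact Finset.sum_le_sum fun w _ => Grimmett1999_theta_sq_le_openConn_holds 3 (criticalProbI 3) 0 w
  exact pow_eq_zero_iff two_ne_zero |>.1 (le_antisymm hsq (sq_nonneg _))

/-- **The crux `LowPointBookkeeping` from (A♯ₛ) and (B♯)** (its own hypotheses A, B, C are idle):
`θ(p_c) = 0` gives the axis conclusion through the landed column-sum equivalence. -/
theorem lowPointBookkeeping_of_sharp (hA : SharpFloorTwoArm) (hB : NoFatHalfBox) :
    LowPointBookkeeping := by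
  intro _ _ _
  have hcont := percolationContinuityZ3_of_sharp hA hB
  have hcol := percolationContinuityZ3_iff_tendsto_columnSum.1 hcont
  have hfloor := LowPoint.tendsto_measure_openConnIn_halfSpace_axis
  have hsum : Tendsto (fun n : ℕ => bondPercolation (zdGraph 3) (criticalProbI 3)
      (openConn (0 : Site 3) (Pi.single 0 (n : ℤ)))) atTop (𝓝 0) := by
    have key : ∀ n : ℕ, bondPercolation (zdGraph 3) (criticalProbI 3)
        (openConn (0 : Site 3) (Pi.single 0 (n : ℤ))) =
        bondPercolation (zdGraph 3) (criticalProbI 3)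
          (openConnIn {x : Site 3 | 0 ≤ x 0} 0 (Pi.single 0 (n : ℤ))) +
        ∑' t : ℕ, bondPercolation (zdGraph 3) (criticalProbI 3)
          (openConnIn {x : Site 3 | 0 ≤ x 0} (Pi.single 0 ((t : ℤ) + 1))
              (Pi.single 0 ((n : ℤ) + (t : ℤ) + 1)) \
            openConnIn {x : Site 3 | 1 ≤ x 0} (Pi.single 0 ((t : ℤ) + 1))
              (Pi.single 0 ((n : ℤ) + (t : ℤ) + 1))) := by
      intro n
      rw [LowPoint.measure_openConn_eq_column_add_tsum (criticalProbI 3) (Pi.single 0 (n : ℤ))]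
      congr 1
      refine tsum_congr fun t => ?_
      rw [LowPoint.single_add_single_succ]
    simp_rw [key]
    simpa using hfloor.add hcol
  have h2 := (ENNReal.tendsto_toReal ENNReal.zero_ne_top).comp hsum
  rw [ENNReal.toReal_zero] at h2
  exact h2

/-- **The route's `Assembly` from (A♯ₛ) and (B♯)** (A, B, C idle). -/
theorem assembly_of_sharp (hA : SharpFloorTwoArm) (hB : NoFatHalfBox) : Assembly :=
  fun _ _ _ => percolationContinuityZ3_of_sharp hA hB

/-! ### (A♯ₛ) implies the route's crux A (`BoundaryTwoArmDecay`) -/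

/-- An arm event `{∃ y far from x, x ↔_ℍ y}` is determined by the pairs of points of `ℍ`. -/
theorem determinedBy_arm (P : Site 3 → Prop) (x : Site 3) :
    DeterminedBy {ω : BondConfig (Site 3) | ∃ y : Site 3, P y ∧ ω ∈ openConnIn HS x y} HS.sym2 := by
  rw [determinedBy_iff]
  intro ω ω' h
  simp only [Set.mem_setOf_eq]
  refine exists_congr fun y => and_congr_right fun _ => ?_
  exact (determinedBy_iff _ _).1 (DCT16.determinedBy_openConnIn HS x y subset_rfl) ω ω' h

/-- An arm event `{∃ y far from x, x ↔_ℍ y}` is measurable. -/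
theorem measurableSet_arm (P : Site 3 → Prop) (x : Site 3) :
    MeasurableSet {ω : BondConfig (Site 3) | ∃ y : Site 3, P y ∧ ω ∈ openConnIn HS x y} := by
  have : {ω : BondConfig (Site 3) | ∃ y : Site 3, P y ∧ ω ∈ openConnIn HS x y} =
      ⋃ y : {y : Site 3 // P y}, (openConnIn HS x (y : Site 3) : Set (BondConfig (Site 3))) := by
    ext ω
    simp only [Set.mem_setOf_eq, Set.mem_iUnion, Subtype.exists, exists_prop]
  rw [this]
  exact MeasurableSet.iUnion fun y => measurableSet_openConnIn_of_countable _ _ _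

/-- At `s = 1` the floor-diluted measure gives the sharp two-arm event its `P_{p_c}`-probability
(both are product measures with the same weights on the pairs of points of `ℍ`, and the event is
determined by those pairs). -/
theorem floorDiluted_one_real_twoArm (e : Site 3) (r : ℕ) :
    (μH 1).real
        ({ω | ∃ y : Site 3, (∃ i : Fin 3, ((r : ℕ) : ℤ) ≤ |y i|) ∧ ω ∈ openConnIn {x : Site 3 | 0 ≤ x 0} 0 y} ∩
          {ω | ∃ y : Site 3, (∃ i : Fin 3, ((r : ℕ) : ℤ) ≤ |y i - e i|) ∧ ω ∈ openConnIn {x : Site 3 | 0 ≤ x 0} e y} ∩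
          (openConnIn {x : Site 3 | 0 ≤ x 0} 0 e)ᶜ) =
      (μc).real
        ({ω | ∃ y : Site 3, (∃ i : Fin 3, ((r : ℕ) : ℤ) ≤ |y i|) ∧ ω ∈ openConnIn {x : Site 3 | 0 ≤ x 0} 0 y} ∩
          {ω | ∃ y : Site 3, (∃ i : Fin 3, ((r : ℕ) : ℤ) ≤ |y i - e i|) ∧ ω ∈ openConnIn {x : Site 3 | 0 ≤ x 0} e y} ∩
          (openConnIn {x : Site 3 | 0 ≤ x 0} 0 e)ᶜ) := by
  have hdet : DeterminedBy
      ({ω | ∃ y : Site 3, (∃ i : Fin 3, ((r : ℕ) : ℤ) ≤ |y i|) ∧ ω ∈ openConnIn {x : Site 3 | 0 ≤ x 0} 0 y} ∩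
          {ω | ∃ y : Site 3, (∃ i : Fin 3, ((r : ℕ) : ℤ) ≤ |y i - e i|) ∧ ω ∈ openConnIn {x : Site 3 | 0 ≤ x 0} e y} ∩
          (openConnIn {x : Site 3 | 0 ≤ x 0} 0 e)ᶜ : Set (BondConfig (Site 3))) HS.sym2 :=
    ((determinedBy_arm (fun y : Site 3 => ∃ i : Fin 3, ((r : ℕ) : ℤ) ≤ |y i|) 0).inter
      (determinedBy_arm (fun y : Site 3 => ∃ i : Fin 3, ((r : ℕ) : ℤ) ≤ |y i - e i|) e)).inter
      (DCT16.determinedBy_openConnIn HS 0 e subset_rfl).compl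
  have hmeas : MeasurableSet
      ({ω | ∃ y : Site 3, (∃ i : Fin 3, ((r : ℕ) : ℤ) ≤ |y i|) ∧ ω ∈ openConnIn {x : Site 3 | 0 ≤ x 0} 0 y} ∩
          {ω | ∃ y : Site 3, (∃ i : Fin 3, ((r : ℕ) : ℤ) ≤ |y i - e i|) ∧ ω ∈ openConnIn {x : Site 3 | 0 ≤ x 0} e y} ∩
          (openConnIn {x : Site 3 | 0 ≤ x 0} 0 e)ᶜ : Set (BondConfig (Site 3))) :=
    ((measurableSet_arm (fun y : Site 3 => ∃ i : Fin 3, ((r : ℕ) : ℤ) ≤ |y i|) 0).inter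
      (measurableSet_arm (fun y : Site 3 => ∃ i : Fin 3, ((r : ℕ) : ℤ) ≤ |y i - e i|) e)).inter
      (measurableSet_openConnIn_of_countable _ _ _).compl
  simp only [measureReal_def]
  rw [floorDilutedPercolation_one_apply_eq (criticalProbI 3) hdet hmeas]

/-- **(A♯ₛ) ⇒ A**: the sharp floor-uniform two-arm bound at `s = 1`, `e = (0,1,0)` gives the route's
`BoundaryTwoArmDecay` (same `κ`, constant `max C 0`; `r^{-(11/4+κ)} ≤ r^{-(5/2+κ)}` for `r ≥ 1`). -/
theorem boundaryTwoArmDecay_of_sharp (hA : SharpFloorTwoArm) : BoundaryTwoArmDecay := by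
  obtain ⟨κ, C, hκ, h⟩ := hA
  have he : (Pi.single 1 1 : Site 3) ∈
      ({Pi.single 1 1, Pi.single 1 (-1), Pi.single 2 1, Pi.single 2 (-1)} : Finset (Site 3)) :=
    Finset.mem_insert_self _ _
  refine ⟨κ, max C 0, hκ, fun r hr => ?_⟩
  have h1 := h 1 _ he r hr
  rw [floorDiluted_one_real_twoArm] at h1
  have hr1 : (1 : ℝ) ≤ r := by exact_mod_cast hr
  refine le_trans (le_of_eq ?_) (h1.trans ?_)
  · congr 1
    ext ω
    simp only [Set.mem_inter_iff, Set.mem_setOf_eq, Set.mem_compl_iff, and_assoc]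
  · calc C * (r : ℝ) ^ (-(11 / 4 + κ)) ≤ max C 0 * (r : ℝ) ^ (-(11 / 4 + κ)) :=
          mul_le_mul_of_nonneg_right (le_max_left _ _) (by positivity)
      _ ≤ max C 0 * (r : ℝ) ^ (-(5 / 2 + κ)) :=
          mul_le_mul_of_nonneg_left (Real.rpow_le_rpow_of_exponent_le hr1 (by linarith))
            (le_max_right _ _)

/-- **Registered wrapper `stub_glueConclusion`** (def-free signature, registered on the crux item):
(A♯ₛ) → (B♯) → `LowPointBookkeeping`, verbatim `lowPointBookkeeping_of_sharp`. -/
theorem stub_glueConclusion : (∃ κ C : ℝ, 0 < κ ∧ ∀ s : unitInterval, ∀ e ∈ ({Pi.single 1 1, Pi.single 1 (-1), Pi.single 2 1, Pi.single 2 (-1)} : Finset (Site 3)), ∀ r : ℕ, 1 ≤ r → (floorDilutedPercolation 3 (criticalProbI 3) s).real ({ω | ∃ y : Site 3, (∃ i : Fin 3, ((r : ℕ) : ℤ) ≤ |y i|) ∧ ω ∈ openConnIn {x : Site 3 | 0 ≤ x 0} 0 y} ∩ {ω | ∃ y : Site 3, (∃ i : Fin 3, ((r : ℕ) : ℤ)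 ≤ |y i - e i|) ∧ ω ∈ openConnIn {x : Site 3 | 0 ≤ x 0} e y} ∩ (openConnIn {x : Site 3 | 0 ≤ x 0} 0 e)ᶜ) ≤ C * (r : ℝ) ^ (-(11 / 4 + κ))) → (∃ C : ℝ, 0 < C ∧ ∀ x ∈ insert (0 : Site 3) ({Pi.single 1 1, Pi.single 1 (-1), Pi.single 2 1, Pi.single 2 (-1)} : Finset (Site 3)), ∀ n : ℕ, 1 ≤ n → (floorDilutedPercolation 3 (criticalProbI 3) 1).real {ω | C * (n : ℝ) ^ ((11 : ℝ) / 4) ≤ (clusterMaxIn (((box 3 n).image fun y : Site 3 => x + y).filter fun z : Site 3 => 0 ≤ z 0) ω : ℝ)} ≤ Real.exp (-1)) → Summit.CriticalPhenomena.PercolationContinuityZ3.Theses.PercLowPointHalfSpace.LowPointBookkeeping :=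
  fun hA hB => lowPointBookkeeping_of_sharp hA hB

end Summit.CriticalPhenomena.PercolationContinuityZ3.Theorems.FloorRusso.Glue

end
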